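import Literature.NumberTheory.EllipticCurves.IsogenyFormulaOfPlace
import HarnessLib

/-!
# Reducing the identity `ψ ∘ ψ = [c]` for a formula isogeny modulo a place (AT II.4.4)

Topic `NumberTheory/EllipticCurves` (trunk T-ELLARITH, notion `cm_endomorphisms_isogeny`).
Sibling of `Literature.NumberTheory.EllipticCurves.IsogenyFormulaOfPlace`: there, an isogeny
formula `Φ : W₀ → W₀` over a ring `R₀` with good reduction at a place above `p` yields an isogeny
`ψ̄ = Φ.toIsogenyOfPlace` of `W₀ ⊗ 𝔽_p` over `𝔽_p`. Here we prove that **a polynomial identity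
satisfied by the formula in characteristic `0` descends to `ψ̄`**:

* `WeierstrassCurve.IsogenyFormula.toIsogenyOfPlace_comp_self` — if over a field `F` of
  characteristic `0` (through `f_F : R₀ → F`, compatibly with the place: `A ∩ F ⊇ f_F(R₀)`) some
  map `ψ_F` on `W₀(F̄)` agrees with the formula off its exceptional set and satisfies
  `ψ_F (ψ_F Q) = c • Q` for all `Q`, then `ψ̄ (ψ̄ P) = c • P` for all `P ∈ W₀(𝔽̄_p)`.

This is the reduction of endomorphisms of Silverman, *Advanced Topics*, Prop. II.4.4 ("the
natural reduction map `End(E) → End(Ẽ)` … is a ring homomorphism"), for explicit formulae and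
the single relation needed for Deuring's theorem (`[√d]² = [d]`,
`ComplexMultiplicationDeuringReductionProofs`). Proof: off a finite set of `P` (the exceptional
points and their preimages under `ψ̄`, finite by the tree's
`AddMonoidHom.finite_preimage_of_finite_ker` of `IsogenyGeomEndRingProofs`), transport `P` to the residue field `k` of the place, lift
to a `K`-point `X` of the integral model (`exists_reducePoint_eq`, the place is henselian),
apply the identity upstairs to `X` read in `W₀(F̄)`, and reduce twice with
`IsogenyFormula.reducePoint_pointFun` (reduction commutes with the formula where `h` is a unit)
and once with the additivity of reduction (`reducePoint_add`, for `[c]`); both sides being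
homomorphisms, the identity holds everywhere.

## References

* [SilvermanAdvancedTopics1994] J. H. Silverman, *Advanced Topics in the Arithmetic of Elliptic
  Curves*, GTM 151 (1994), Prop. II.4.4.
* [SilvermanAEC2009] J. H. Silverman, *The Arithmetic of Elliptic Curves*, 2nd ed. (2009),
  Prop. VII.2.1, Thm. III.4.8.

## Design

Theorems only; `noncomputable section`, `open scoped Classical`; dot-notation extensions in
`namespace WeierstrassCurve.IsogenyFormula`. The characteristic-`0` endomorphism enters only
through the two hypotheses `hψF` (agreement with the formula) and `hψψ` (the identity), so that
the file is independent of how `ψ_F` was constructed.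
-/

noncomputable section

open scoped Classical

open Polynomial IsLocalRing

universe u

namespace WeierstrassCurve

/-! ## Generalities -/

section General

variable {K : Type u} [Field K] {Γ₀ : Type*} [LinearOrderedCommGroupWithZero Γ₀]
  {v : Valuation K Γ₀} {R : Type*} [CommRing R] [IsLocalRing R] [Algebra R K]
  (W : WeierstrassCurve R) [W.IsElliptic]

/-- **Reduction as a homomorphism on all points, for good reduction** (Silverman, *AEC*,
Prop. VII.2.1 with `E₀ = E` when `Δ` is a unit: the tree's `hasNonsingularReduction_of_isUnit_Δ`
of `GeomPointReduction`).
[cite: SilvermanAEC2009, Prop. VII.2.1] -/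
def reduceAddMonoidHom (hv : v.Integers R) :
    (W.baseChange K).toAffine.Point →+ (W.map (residue R)).toAffine.Point :=
  AddMonoidHom.mk' W.reducePoint fun P Q ↦
    reducePoint_add hv
      (Literature.NumberTheory.EllipticCurves.hasNonsingularReduction_of_isUnit_Δ hv W.isUnit_Δ P)
      (Literature.NumberTheory.EllipticCurves.hasNonsingularReduction_of_isUnit_Δ hv W.isUnit_Δ Q)

/-- `reduceAddMonoidHom` is `reducePoint`. [folklore] -/
@[simp] theorem reduceAddMonoidHom_apply (hv : v.Integers R) (P : (W.baseChange K).toAffine.Point) :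
    W.reduceAddMonoidHom hv P = W.reducePoint P := rfl

/-- Reduction commutes with multiplication by an integer (good reduction). [folklore] -/
theorem reducePoint_zsmul (hv : v.Integers R) (c : ℤ) (P : (W.baseChange K).toAffine.Point) :
    W.reducePoint (c • P) = c • W.reducePoint P := by
  rw [← reduceAddMonoidHom_apply W hv, map_zsmul, reduceAddMonoidHom_apply]

end General

namespace IsogenyFormula

/-! ## The setting -/

section CompSelf

variable {R₀ : Type} [CommRing R₀] {W₀ : WeierstrassCurve R₀} (Φ : IsogenyFormula W₀ W₀)
  (p : ℕ) [Fact p.Prime] (f₀ : R₀ →+* ZMod p)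
  (hU₀ : f₀ Φ.U.leadingCoeff ≠ 0) (hh₀ : f₀ Φ.h.leadingCoeff ≠ 0)
  -- the characteristic-`0` side
  {F : Type u} [Field F] [CharZero F] (fF : R₀ →+* F)
  (ΦF : IsogenyFormula (W₀.map fF) (W₀.map fF))
  (hΦU : ΦF.U = Φ.U.map fF) (hΦh : ΦF.h = Φ.h.map fF) (hΦS : ΦF.S = Φ.S.map fF)
  (hΦT : ΦF.T = Φ.T.map fF)
  -- the place
  (A : ValuationSubring (AlgebraicClosure F)) (fA : R₀ →+* A)
  (hFA : (algebraMap A (AlgebraicClosure F)).comp fA = (algebraMap F (AlgebraicClosure F)).comp fF)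
  (hUA : IsUnit (fA Φ.U.leadingCoeff)) (hhA : IsUnit (fA Φ.h.leadingCoeff))
  (g : AlgebraicClosure (ZMod p) →+* ResidueField A)
  (hg : (g.comp (algebraMap (ZMod p) (AlgebraicClosure (ZMod p)))).comp f₀ = (residue A).comp fA)

omit [CharZero F] in
include hFA in
/-- The integral model over `A` and the model over `F` agree over `F̄`. [folklore] -/
theorem baseChange_map_id_eq :
    ((W₀.map fA).baseChange (AlgebraicClosure F)).map (RingHom.id (AlgebraicClosure F)) = (W₀.map fF).baseChange (AlgebraicClosure F) := by
  rw [map_id, baseChange, baseChange, map_map, map_map, hFA]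

omit [CharZero F] in
include hFA in
/-- Polynomial data over `F̄` agree. [folklore] -/
theorem map_map_id_eq (q : R₀[X]) :
    ((q.map fA).map (algebraMap A (AlgebraicClosure F))).map (RingHom.id (AlgebraicClosure F)) = (q.map fF).map (algebraMap F (AlgebraicClosure F)) := by
  rw [Polynomial.map_id, Polynomial.map_map, Polynomial.map_map, hFA]

variable [(W₀.map fF).IsElliptic] [(W₀.map fA).IsElliptic]

omit [CharZero F] in
include hFA hΦU hΦh hΦS hΦT in
/-- **Over `F̄` the formula of the `F`-model and the generic formula of the `A`-model have the
same point map**, read through the identification of the two models (`mapPoint (RingHom.id F̄)`).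
[folklore] -/
theorem mapPoint_gen_pointFun (X : ((W₀.map fA).baseChange (AlgebraicClosure F)).toAffine.Point) :
    mapPoint (RingHom.id (AlgebraicClosure F)) (baseChange_map_id_eq fF A fA hFA)
        (((Φ.atPlace A fA hUA hhA).gen A).pointFun X) =
      ΦF.geom.pointFun (mapPoint (RingHom.id (AlgebraicClosure F)) (baseChange_map_id_eq fF A fA hFA) X) := by
  refine mapPoint_pointFun (RingHom.id (AlgebraicClosure F)) _ _ _ _ ?_ ?_ ?_ ?_ X
  · change ΦF.h.map (algebraMap F (AlgebraicClosure F)) = ((Φ.h.map fA).map (algebraMap A (AlgebraicClosure F))).map (RingHom.id (AlgebraicClosure F))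
    rw [map_map_id_eq fF A fA hFA, hΦh]
  · change ΦF.U.map (algebraMap F (AlgebraicClosure F)) = ((Φ.U.map fA).map (algebraMap A (AlgebraicClosure F))).map (RingHom.id (AlgebraicClosure F))
    rw [map_map_id_eq fF A fA hFA, hΦU]
  · change ΦF.S.map (algebraMap F (AlgebraicClosure F)) = ((Φ.S.map fA).map (algebraMap A (AlgebraicClosure F))).map (RingHom.id (AlgebraicClosure F))
    rw [map_map_id_eq fF A fA hFA, hΦS]
  · change ΦF.T.map (algebraMap F (AlgebraicClosure F)) = ((Φ.T.map fA).map (algebraMap A (AlgebraicClosure F))).map (RingHom.id (AlgebraicClosure F))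
    rw [map_map_id_eq fF A fA hFA, hΦT]

omit [CharZero F] [(W₀.map fF).IsElliptic] [(W₀.map fA).IsElliptic] in
include hFA hΦh in
/-- The exceptional sets over `F̄` correspond. [folklore] -/
theorem mapPoint_mem_geom_bad_iff (X : ((W₀.map fA).baseChange (AlgebraicClosure F)).toAffine.Point) :
    mapPoint (RingHom.id (AlgebraicClosure F)) (baseChange_map_id_eq fF A fA hFA) X ∈ ΦF.geom.bad ↔
      X ∈ ((Φ.atPlace A fA hUA hhA).gen A).bad := by
  refine mapPoint_mem_bad_iff (RingHom.id (AlgebraicClosure F)) _ _ _ ?_ X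
  change ΦF.h.map (algebraMap F (AlgebraicClosure F)) = ((Φ.h.map fA).map (algebraMap A (AlgebraicClosure F))).map (RingHom.id (AlgebraicClosure F))
  rw [map_map_id_eq fF A fA hFA, hΦh]

variable [(W₀.map f₀).IsElliptic]
  (ψF : (W₀.map fF).geomPoints → (W₀.map fF).geomPoints)
  (hψF : ∀ Q, Q ∉ ΦF.geom.bad → ψF Q = ΦF.geom.pointFun Q)
  (c : ℤ) (hψψ : ∀ Q, ψF (ψF Q) = c • Q)

include hFA hΦU hΦh hΦS hΦT hψF hψψ in
/-- **Reduction of the identity `ψ ∘ ψ = [c]` to characteristic `p`** (Silverman, *Advanced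
Topics*, Prop. II.4.4: reduction of endomorphisms is a ring homomorphism — here for the explicit
formula `Φ` and the one relation `ψ² = c`). If over `F̄` a map `ψ_F` agrees with the formula `Φ`
off its exceptional set and satisfies `ψ_F (ψ_F Q) = c • Q` everywhere, then the isogeny
`ψ̄ = Φ.toIsogenyOfPlace` over `𝔽_p` satisfies `ψ̄ (ψ̄ P) = c • P` for every `P ∈ W₀(𝔽̄_p)`.
[cite: SilvermanAdvancedTopics1994, Prop. II.4.4] -/
theorem toIsogenyOfPlace_comp_self (P : (W₀.map f₀).geomPoints) :
    Φ.toIsogenyOfPlace p f₀ hU₀ hh₀ A fA hUA hhA g hg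
        (Φ.toIsogenyOfPlace p f₀ hU₀ hh₀ A fA hUA hhA g hg P) = c • P := by
  set ψ := Φ.toIsogenyOfPlace p f₀ hU₀ hh₀ A fA hUA hhA g hg with hψ
  set bad₀ : Set (W₀.map f₀).geomPoints := ((Φ.red₀ p f₀ hU₀ hh₀).geom.bad : Set _) with hbad₀
  -- both sides are homomorphisms; compare off the finite set `bad₀ ∪ ψ⁻¹ bad₀`
  set B : Set (W₀.map f₀).geomPoints := bad₀ ∪ ψ ⁻¹' bad₀ with hB
  have hBfin : B.Finite :=
    (Φ.red₀ p f₀ hU₀ hh₀).geom.finite_bad.union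
      (Literature.NumberTheory.EllipticCurves.AddMonoidHom.finite_preimage_of_finite_ker ψ.toAddMonoidHom
        ψ.finite_ker (Φ.red₀ p f₀ hU₀ hh₀).geom.finite_bad)
  suffices h : ψ.toAddMonoidHom.comp ψ.toAddMonoidHom = c • AddMonoidHom.id (W₀.map f₀).geomPoints from
    congrArg (fun G : (W₀.map f₀).geomPoints →+ (W₀.map f₀).geomPoints ↦ G P) h
  refine Literature.NumberTheory.EllipticCurves.AddMonoidHom.eq_of_eqOn_compl_finite
    (G := (W₀.map f₀).geomPoints) (S := B) hBfin fun Q hQ ↦ ?_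
  have hQ₀ : Q ∉ bad₀ := fun h ↦ hQ (Or.inl h)
  have hQ₁ : ψ Q ∉ bad₀ := fun h ↦ hQ (Or.inr h)
  change ψ (ψ Q) = c • Q
  -- the place: residue field, henselian, integers
  haveI := Literature.RingTheory.Valuation.henselianRing_maximalIdeal A
  set hv := Literature.NumberTheory.EllipticCurves.integers_valuationRing_valuation A (AlgebraicClosure F) with hv_def
  have hinj : Function.Injective (algebraMap A (AlgebraicClosure F)) := hv.hom_inj
  -- transport to the residue field and lift
  have h₁ := baseChange_map_eq_of_place p f₀ A fA g hg W₀
  set M := mapPoint g h₁ with hM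
  have hMinj : Function.Injective M := mapPoint_injective g h₁
  obtain ⟨X, -, hX⟩ := (W₀.map fA).exists_reducePoint_eq (K := AlgebraicClosure F) hinj (M Q)
  -- the generic/reduced formulas of the model over `A`
  set ΦA := Φ.atPlace A fA hUA hhA with hΦA
  have hUA' := Φ.isUnit_leadingCoeff_atPlace_U A fA hUA hhA
  have hhA' := Φ.isUnit_leadingCoeff_atPlace_h A fA hUA hhA
  -- first application of the formula
  have hXgood : (W₀.map fA).reducePoint X ∉ (ΦA.red A hUA' hhA').bad := by
    rw [hX]
    exact fun h ↦ hQ₀ ((Φ.mapPoint_mem_redAtPlace_bad_iff p f₀ hU₀ hh₀ A fA hUA hhA g hg Q).mp h)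
  obtain ⟨hX₀, e₁⟩ := ΦA.reducePoint_pointFun A hUA' hhA' X hXgood
  rw [hX] at e₁
  -- `e₁ : reduce (Φ X) = Φ̄ (M Q) = M (ψ Q)`
  have c₁ : (ΦA.red A hUA' hhA').pointFun (M Q) = M (ψ Q) :=
    (Φ.mapPoint_toIsogenyOfPlace p f₀ hU₀ hh₀ A fA hUA hhA g hg hQ₀).symm
  rw [c₁] at e₁
  -- second application
  set X₁ := (ΦA.gen A).pointFun X with hX₁
  have hX₁good : (W₀.map fA).reducePoint X₁ ∉ (ΦA.red A hUA' hhA').bad := by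
    rw [e₁]
    exact fun h ↦ hQ₁ ((Φ.mapPoint_mem_redAtPlace_bad_iff p f₀ hU₀ hh₀ A fA hUA hhA g hg _).mp h)
  obtain ⟨hX₁₀, e₂⟩ := ΦA.reducePoint_pointFun A hUA' hhA' X₁ hX₁good
  rw [e₁] at e₂
  have c₂ : (ΦA.red A hUA' hhA').pointFun (M (ψ Q)) = M (ψ (ψ Q)) :=
    (Φ.mapPoint_toIsogenyOfPlace p f₀ hU₀ hh₀ A fA hUA hhA g hg hQ₁).symm
  rw [c₂] at e₂
  -- upstairs: `Φ (Φ X) = c • X`, through `W₀(F̄)`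
  set ι := mapPoint (RingHom.id (AlgebraicClosure F)) (baseChange_map_id_eq fF A fA hFA) with hι
  have hιinj : Function.Injective ι := mapPoint_injective _ _
  have hιX : ι X ∉ ΦF.geom.bad := fun h ↦
    hX₀ ((Φ.mapPoint_mem_geom_bad_iff fF ΦF hΦh A fA hFA hUA hhA X).mp h)
  have hιX₁ : ι X₁ ∉ ΦF.geom.bad := fun h ↦
    hX₁₀ ((Φ.mapPoint_mem_geom_bad_iff fF ΦF hΦh A fA hFA hUA hhA X₁).mp h)
  have u₁ : ψF (ι X) = ι X₁ := by
    rw [hψF _ hιX, hX₁, Φ.mapPoint_gen_pointFun fF ΦF hΦU hΦh hΦS hΦT A fA hFA hUA hhA X]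
  have u₂ : ψF (ι X₁) = ι ((ΦA.gen A).pointFun X₁) := by
    rw [hψF _ hιX₁, Φ.mapPoint_gen_pointFun fF ΦF hΦU hΦh hΦS hΦT A fA hFA hUA hhA X₁]
  have u₃ : (ΦA.gen A).pointFun X₁ = c • X := by
    apply hιinj
    rw [← u₂, ← u₁, hψψ, map_zsmul]
    rfl
  -- reduce
  rw [u₃, reducePoint_zsmul (W₀.map fA) hv c X, hX, ← map_zsmul] at e₂
  exact (hMinj e₂).symm

end CompSelf

end IsogenyFormula

end WeierstrassCurve
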